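import Summits.ResolutionOfSingularities.ResolutionOfSingularities.Theorems.EquisingularLiftEquisingularLiftNatDirectionFrames
import Mathlib.LinearAlgebra.Matrix.NonsingularInverse
import HarnessLib

/-!
# [OURS · L1 W4.5(b) · S6 (L) brick C2, (★) bridge piece X4] A frame times an invertible matrix of sections is a frame

Cell `res-hironaka`, LADDER-RESOLUTION rung L (D-0089), slot W4.5(b), crux chain w45b: working crux
`Theses.EquisingularLift.EquisingularLiftNat` (stmt-ResolutionOfSingularities-20038) / child `EquisingularLiftNatThree`
(stmt-ResolutionOfSingularities-20148); brick C2 of res-L1-w45b-stub-4's `Tower.hLift_of_bricks` (socket `stub_elnat_three_liftSections`),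
keystone (★) `cechPic_pullback_detClass_conormal_section` of res-type-027, bridge piece **X4** of its cut (`L/res-type-027/Bridge-pieces.sig.lean`
d74e4ef5f55702f7), dealt BY SIGNATURE to res-L1-w45b-stub-2 g9 (desk RE-DEAL STATUS l.77779). `--supports stmt-ResolutionOfSingularities-20148
--as helper`. OURS; NOT a statement of any manuscript; AI-written, and AI review is weaker than expert review. No `sorry`, standard axioms, DEF-FREE.

WHAT. **`exists_frame_of_isUnit_det`** — for a frame `e : 𝒪^n ≅ M|_W` and a matrix `P ∈ GL_n(Γ(X, W))` (`IsUnit P.det`), there is a frame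
`e' : 𝒪^n ≅ M|_W` with basis sections `b'_i = Σ_j P_{ij} b_j` (`e' := e ≫ (matrix endomorphism of Pᵀ)`, inverse from Mathlib's
`Matrix.nonsing_inv`; tree `Modules/FrameMatrixEnd.matrixEnd`, `P1VB.basisSection_trans_iso`). Also the `I`-indexed form
`exists_frame_of_isUnit_det'` (any finite index type `I : Type u` with decidable equality, any universe; the `Fin n` form lives over `Scheme.{0}`
because `Fin n : Type 0` indexes `SheafOfModules.free`).

References (index only): R. Hartshorne, *Algebraic Geometry* (1977), II §5 p. 109 (change of basis of a free module) [cite: Hartshorne1977].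
-/

noncomputable section

-- `TopCat.Presheaf`/`Scheme.Modules` are not reducible (as in Mathlib's `AlgebraicGeometry/Modules`).
set_option backward.isDefEq.respectTransparency false

open CategoryTheory AlgebraicGeometry TopologicalSpace Opposite
open Literature.AlgebraicGeometry.Modules Literature.AlgebraicGeometry.Motives

set_option linter.dupNamespace false -- mandated namespace `Summit.<Summit>.<Problem>` of this single-conjunct summit

namespace Summit.ResolutionOfSingularities.ResolutionOfSingularities.Cruxes.EquisingularLiftNat.Sections

universe u

/-- **A frame times an invertible matrix of sections is a frame** (any finite index type): from `e : 𝒪^I ≅ M|_W` and `P ∈ GL_I(Γ(X, W))`,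
a frame `e'` with `b'_i = Σ_j P_{ij} b_j`. [cite: Hartshorne1977, II §5 p. 109 (change of basis)] -/
theorem exists_frame_of_isUnit_det' {X : Scheme.{u}} {M : X.Modules} {W : X.Opens} {I : Type u} [Fintype I] [DecidableEq I]
    (e : SheafOfModules.free I ≅ M.over W) (P : Matrix I I Γ(X, W)) (hP : IsUnit P.det) :
    ∃ e' : SheafOfModules.free I ≅ M.over W, ∀ i, basisSection e' i = ∑ j, P i j • basisSection e j := by
  have hPT : IsUnit P.transpose.det := by rwa [Matrix.det_transpose]
  let f : M.over W ≅ M.over W :=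
    { hom := matrixEnd e (𝟙 W) P.transpose
      inv := matrixEnd e (𝟙 W) P.transpose⁻¹
      hom_inv_id := by rw [matrixEnd_comp, Matrix.nonsing_inv_mul _ hPT, matrixEnd_one]
      inv_hom_id := by rw [matrixEnd_comp, Matrix.mul_nonsing_inv _ hPT, matrixEnd_one] }
  refine ⟨e ≪≫ f, fun i => ?_⟩
  rw [P1VB.basisSection_trans_iso]
  change appLE (matrixEnd e (𝟙 W) P.transpose) (𝟙 W) (basisSection e i) = _
  have h := appLE_matrixEnd_basisSection e (𝟙 W) P.transpose i
  simp_rw [presheaf_map_id] at h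
  rw [h]
  rfl

/-- **X4 — a frame times an invertible matrix of sections is a frame** (res-type-027's signature): from `e : 𝒪^n ≅ M|_W` and
`P ∈ GL_n(Γ(X, W))`, a frame `e' : 𝒪^n ≅ M|_W` with basis sections `b'_i = Σ_j P_{ij} b_j`. [cite: Hartshorne1977, II §5 p. 109 (change of basis)] -/
theorem exists_frame_of_isUnit_det {X : Scheme.{0}} {M : X.Modules} {W : X.Opens} {n : ℕ}
    (e : SheafOfModules.free (Fin n) ≅ M.over W) (P : Matrix (Fin n) (Fin n) Γ(X, W)) (hP : IsUnit P.det) :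
    ∃ e' : SheafOfModules.free (Fin n) ≅ M.over W, ∀ i, basisSection e' i = ∑ j, P i j • basisSection e j :=
  exists_frame_of_isUnit_det' e P hP

end Summit.ResolutionOfSingularities.ResolutionOfSingularities.Cruxes.EquisingularLiftNat.Sections

end
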